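import Summits.AtomisticToContinuum.Crystallization.Theorems.FrustratedLawDichotomyCellF1Pos
import Summits.AtomisticToContinuum.Crystallization.Theorems.FrustratedLawDichotomyCellF1Symm

/-!
# FrustratedLawDichotomy · crux `AperiodicFrustratedLawGap` (stmt-AtomisticToContinuum-27623) — class-A K-file skeleton, layer 4:
the F1 ROW THEOREM modulo the K-certificate (decomp-a2c hand-2 g47, structural share; KFILE-FORMAT ed2 §2 step 7 / ed2c §3″ G1–G5)

The top of the F1 Floor file, data-free: ★ `row_F1` — for ANY multiplier placement `YF` and ANY certified constant, IF the K-inequality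
`2·(cUp + mc) ≤ certFloorL MF1 MIF1 0 (posL F ∘ aF1) (YF F) τ Rc` holds for every `F` of the strain cell `BF1` (this is what the «Classes»/«Near»/«RM»
layers + ONE `decide` deliver), THEN every rooted `7/10`-hard-core NASH configuration in the F1 row `⋃_{F ∈ BF1} coherentAt (MF1.image (posL F ∘ aF1))
τ Rc` has root energy `≥ c + mc` (`c ≤ cUp`).  All geometric hypotheses of (260) `rowFloor_of_nearIdBox` are discharged from layers 1–2g: root at the
origin, `MIF1 ⊆ MF1 ∋ 0`, template separation in the squared form `(2τ)² < (1 − 3ε)·Σ(aF1 m − aF1 m')²` ((270) `sep_of_linTemplate_rows` from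
injectivity of `zT` and the Gershgorin rows — `hsep2_aF1`), the window row `hwin_aF1`, the interior inset row `hI_aF1` (`16 ≤ (Rc − τ − 7/20)²`).
Dials of record: `τ = ε = 2⁻¹⁰`, `Rc = 13`, `δ = 7/10`.  Rule G5: the only function-valued data are the named `aF1` and the binder `YF`.
-/

namespace Summit.AtomisticToContinuum.Crystallization.Theorems.FrustratedLawDichotomyCellF1Row

open MeasureTheory
open scoped BigOperators
open Literature.MathematicalPhysics.StatisticalMechanics (lennardJones rootEnergy)
open Literature.Probability.Process (IsRootedHardCore)
open Summit.AtomisticToContinuum.Crystallization.Theorems.ChargedEnergyGapNegative (E3)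
open Summit.AtomisticToContinuum.Crystallization.Theorems.FrustratedLawDichotomyCoherentSets (coherentAt)
open Summit.AtomisticToContinuum.Crystallization.Theorems.FrustratedLawDichotomyCellFrame (certFloorL)
open Summit.AtomisticToContinuum.Crystallization.Theorems.FrustratedLawDichotomyCellMetric (posL)
open Summit.AtomisticToContinuum.Crystallization.Theorems.FrustratedLawDichotomyCellData (rowFloor_of_nearIdBox)
open Summit.AtomisticToContinuum.Crystallization.Theorems.FrustratedLawDichotomyCellTriples (zT zT_inj_on)
open Summit.AtomisticToContinuum.Crystallization.Theorems.FrustratedLawDichotomyCellLinSep (sep_of_linTemplate_rows)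
open Summit.AtomisticToContinuum.Crystallization.Theorems.FrustratedLawDichotomyCellF1Frame (T t_rows)
open Summit.AtomisticToContinuum.Crystallization.Theorems.FrustratedLawDichotomyCellF1Labels (MF1 MIF1 zero_mem_M MI_subset_M)
open Summit.AtomisticToContinuum.Crystallization.Theorems.FrustratedLawDichotomyCellF1Symm (BF1)
open Summit.AtomisticToContinuum.Crystallization.Theorems.FrustratedLawDichotomyCellF1Pos (aF1 aF1_root hwin_aF1 hint_aF1)

/-- (hsep, squared template form) `(2τ)² < (1 − 3ε)·Σᵢ(aF1 m − aF1 m')ᵢ²` for distinct labels (injectivity of `zT` + Gershgorin `2/5`). -/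
theorem hsep2_aF1 : ∀ m ∈ MF1, ∀ m' ∈ MF1, m ≠ m' →
    (2 * (1 / 1024 : ℝ)) ^ 2 < (1 - 3 * (1 / 1024 : ℝ)) * ∑ i, (aF1 m i - aF1 m' i) ^ 2 :=
  sep_of_linTemplate_rows (zT_inj_on MF1) T t_rows (by norm_num) (by norm_num) (by norm_num)

/-- (hI) the interior inset row `(1 + 3ε)·Σᵢ(aF1 m)ᵢ² ≤ (Rc − τ − 7/20)²` on `MIF1`. -/
theorem hI_aF1 : ∀ m ∈ MIF1, (1 + 3 * (1 / 1024 : ℝ)) * ∑ i, aF1 m i ^ 2 ≤ (13 - 1 / 1024 - 7 / 20) ^ 2 :=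
  fun m hm => (hint_aF1 m hm).trans (by norm_num)

/-- ★★ THE F1 ROW THEOREM modulo the K-certificate: if `2·(cUp + mc) ≤ certFloorL …` uniformly over the strain cell (the «Classes»/«Near»/«RM» layers and
ONE decided inequality), every rooted `7/10`-hard-core NASH configuration of the F1 row has root energy at least `c + mc`. -/
theorem row_F1 (YF : Matrix (Fin 3) (Fin 3) ℝ → ℤ × ℤ × ℤ → E3) {c mc cUp : ℝ} (hc : c ≤ cUp)
    (hcert : ∀ F ∈ BF1, 2 * (cUp + mc) ≤ certFloorL MF1 MIF1 0 (fun m => posL F (aF1 m)) (YF F) (1 / 1024) 13)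
    (μ : Measure E3) (hμ : IsRootedHardCore (7 / 10) μ)
    (hNash : ∀ p : E3, μ {p} ≠ 0 → ∀ w : E3, (∀ q : E3, μ {q} ≠ 0 → q ≠ p → w ≠ q) →
      ∑' q : {q : E3 // μ {q} ≠ 0 ∧ q ≠ p}, lennardJones (dist p (q : E3)) ≤
        ∑' q : {q : E3 // μ {q} ≠ 0 ∧ q ≠ p}, lennardJones (dist w (q : E3)))
    (hrow : μ ∈ ⋃ F ∈ BF1, coherentAt (MF1.image fun m => posL F (aF1 m)) (1 / 1024) 13) :
    c + mc ≤ rootEnergy lennardJones μ :=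
  rowFloor_of_nearIdBox (1 / 1024) BF1 (fun _ hF => hF) MF1 MIF1 0 aF1 YF (by norm_num) (by norm_num) (by norm_num)
    zero_mem_M MI_subset_M aF1_root hsep2_aF1 (by norm_num) hwin_aF1 (by norm_num) hI_aF1 hc hcert μ hμ hNash hrow

end Summit.AtomisticToContinuum.Crystallization.Theorems.FrustratedLawDichotomyCellF1Row
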